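import Summits.Ventures.PercRepro.RankLevelSetLevelSixHeavyCellSq27DI2VX6
import Summits.Ventures.PercRepro.RankLevelSetTriangleUnionConfined
import Summits.Ventures.PercRepro.RankLevelSetConfinedBounds
import Summits.Ventures.PercRepro.RankLevelSetLevelSixT22Cell8Partial
import Summits.Ventures.PercRepro.RankLevelSetLevelSixArithConf_confA_sq22F8
import Summits.Ventures.PercRepro.RankLevelSetLevelSixArithConf_confB_sq22F8
import Summits.Ventures.PercRepro.RankLevelSetLevelSixArithConf_confC_sq22F8

/-!
# PercRepro — THE CORE CELL `(22, 8)` OF THE 22 ROW: THE `s₃ ≥ 7` BRANCHES BY FORM (ii) OF THE CONFINEMENT LEMMA, AND THE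
UNCONDITIONAL CELL (p8 g12, S3)

`proofs/P8-G12-LEVER22.md` §7. With `S₃` = the union of the triangles, `ν(S₃) ≥ cq3⁻¹(s₃)` (p3's table on `M ↾ S₃`) and
`|S₃| ≤ 3ν(S₃)` (g11's union lemma), every coindependent `6`-set has `|B ∖ S₃| ≤ 8 − ν(S₃)`, so the coindependent independent
`6`-sets number at most the numeral `X6` of the admissible `(ν, σ)` grid (`RankLevelSetConfinedBounds`) — the cell
`c025_core_six_heavy_cell_sq27di2v_x6` with that `X6`. The coloop-free cell `(22, 8)`: `s₃ ≤ 2`, `3 … 6` (T22Free8Partial), `7 … 9`,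
`10`, `11` (here; the cap `s₃ ≤ 11` is THE TRIANGLE DROP). The every-core terminal `(20, 8)` at shift `8`: `s₃ ≤ 2`, `3 … 6`
(T22Cell8Partial), `7`, `8 … 10`, `11`, `12 … 13` (here; the cap `s₃ ≤ 13` is p3's table). Hence
`c025_core_six_twentytwo_8 : RLS M 22 6` on every `e`-free core of rank `22`, corank `8`. Axioms: standard.
-/

open scoped Matroid

namespace PercRepro

namespace ThmN

open Set

variable {α : Type}

set_option maxHeartbeats 1600000 in
/-- **The coloop-free cell `(22, 8)`, the branch `7 ≤ s₃ ≤ 9`** (form (ii), `X6 = 400400`). -/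
theorem c025_core_six_t22_free8_confA_sq22F8 (M : Matroid α) [M.Finite] (hcf : ∀ e ∈ M.E, ¬ M.IsColoop e)
    (hR : M.eRank = (22 : ℕ∞)) (hn : M.E.ncard = 22 + 8)
    (hfree : ∀ e ∈ M.E, ∃ A ⊆ M.E \ {e}, e ∉ M.closure A ∧ e ∉ M.closure ((M.E \ {e}) \ A))
    (hs3 : {C : Set α | M.IsCircuit C ∧ C.ncard = 3}.ncard ≤ 9)
    (hlo : 7 ≤ {C : Set α | M.IsCircuit C ∧ C.ncard = 3}.ncard) :
    RLS M 22 6 := by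
  classical
  have hR' : M.eRank = ((22 : ℕ) : ℕ∞) := hR
  have hd : M.E.encard = M.eRank + (8 : ℕ) := by
    rw [hR, ← M.ground_finite.cast_ncard_eq, hn]
    push_cast
    ring
  have hc : ∀ X ⊆ M.E, M.eRk X ≤ ((6 - 2 : ℕ) : ℕ∞) → (X.ncard : ℕ∞) ≤ M.eRk X + cnull 4 :=
    fun X hX hr => nullity_cap_core M hfree 4 (le_refl 4) X hX (by simpa using hr)
  have hc6 : cnull 4 + 1 ≤ 7 := by simp [cnull]
  have hcj : ∀ X ⊆ M.E, M.eRk X ≤ ((6 - 2 - 1 : ℕ) : ℕ∞) → (X.ncard : ℕ∞) ≤ M.eRk X + cnull (3) :=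
    fun X hX hr => nullity_cap_core M hfree 3 (by omega) X hX
      (by rwa [show (6 - 2 - 1 : ℕ) = 3 by omega] at hr)
  have hcj' : ∀ X ⊆ M.E, M.eRk X ≤ ((6 - 1 - 1 - 1 : ℕ) : ℕ∞) → (X.ncard : ℕ∞) ≤ M.eRk X + cnull (3) :=
    fun X hX hr => nullity_cap_core M hfree 3 (by omega) X hX
      (by rwa [show (6 - 1 - 1 - 1 : ℕ) = 3 by omega] at hr)
  have hUG : (Matroid.UG M 6 7).ncard ≤ 13 := by
    have := Matroid.ncard_UG_le_cf (M := M) (q := 6) (ν₁ := 7) (j := 2) (by norm_num) hcf hR' hn (by omega) hc hc6 hcj (by norm_num [cnull])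
    simpa using this
  have hUH : (Matroid.UH M 6 7).ncard ≤ 12 := by
    have := Matroid.ncard_UH_le_cf (M := M) (q := 6) (ν₁ := 7) (j' := 1) (by norm_num) hcf hR' hn (by omega) hc hc6 hcj' (by norm_num [cnull])
    simpa using this
  have hΦ : phiK 22 6 ≤ (2 : ℚ) ^ (22 + 6) / (((22 + 6).choose 6 : ℕ) : ℚ) := phiK_le_two_pow_div_six 22
  obtain ⟨ν, σ, hνd, hσ, hσn, hcq, hcount⟩ := exists_triangle_union_bound M hfree hR' hn
  have hν0 : 5 ≤ ν := by
    by_contra hlt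
    have := cq3_lt_seven_of_lt_five ν (by omega)
    omega
  have hX := confined_bound_30_8_5 ν σ hν0 (by omega) hσ (by omega)
  have hX' : ∑ b ∈ Finset.range (8 - ν + 1), (22 + 8 - σ).choose b * σ.choose (6 - b) ≤ 400400 := by
    rw [show (22 : ℕ) + 8 = 30 by norm_num]; exact hX
  have h6 : {B : Set α | B ⊆ M.E ∧ B.ncard = 6 ∧ M.eRk B = 6 ∧ M.eRk (M.E \ B) = M.eRank}.ncard ≤ 400400 := by
    have hsub : {B : Set α | B ⊆ M.E ∧ B.ncard = 6 ∧ M.eRk B = 6 ∧ M.eRk (M.E \ B) = M.eRank} ⊆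
        {B : Set α | B ⊆ M.E ∧ B.ncard = 6 ∧ M.eRk (M.E \ B) = ((22 : ℕ) : ℕ∞)} := by
      rintro B ⟨hBE, hB6, _, hBs⟩
      exact ⟨hBE, hB6, by rw [← hR']; exact hBs⟩
    have hle := Set.ncard_le_ncard hsub (M.ground_finite.finite_subsets.subset (fun B hB => hB.1))
    exact hle.trans (hcount.trans hX')
  rw [RLS_iff]
  exact c025_core_six_heavy_cell_sq27di2v_x6 M 22 8 7 13 12 0 10000 300 14 432 62 9 1155 2238
      ((22 + 6).choose 6) (Nat.choose_pos (by omega)) (phiK 22 6) hΦ (by norm_num) (by omega)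
      (by norm_num) hUG hUH (by omega) (Or.inl (by norm_num)) (by norm_num) (by norm_num) (by norm_num)
      hs3
      ((S1.ncard_fourCircuits_le_gb14 8 M hfree hd 30 (by rw [coloops_eq_empty_of_forall M hcf, Set.sdiff_empty, hn])).trans (by decide))
      (s5_cf_of M hfree hcf (d := 7) (by rw [hd]; norm_num) 30 360 432 (by norm_num) (by omega) (by decide) (by omega))
      (s6_cf_of M hfree hcf (d := 7) (by rw [hd]; norm_num) 30 924 1155 (by norm_num) (by omega) (by decide) (by omega))
      (s7_cf_of M hfree hcf (d := 7) (by rw [hd]; norm_num) 30 1716 2238 (by norm_num) (by omega) (by decide) (by omega))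
      (Or.inl tail_six_confA_sq22F8) hR' hn hfree 400400 h6 level_six_poly_confA_sq22F8

set_option maxHeartbeats 1600000 in
/-- **The coloop-free cell `(22, 8)`, the branch `s₃ = 10`** (form (ii), `X6 = 323340`). -/
theorem c025_core_six_t22_free8_confB_sq22F8 (M : Matroid α) [M.Finite] (hcf : ∀ e ∈ M.E, ¬ M.IsColoop e)
    (hR : M.eRank = (22 : ℕ∞)) (hn : M.E.ncard = 22 + 8)
    (hfree : ∀ e ∈ M.E, ∃ A ⊆ M.E \ {e}, e ∉ M.closure A ∧ e ∉ M.closure ((M.E \ {e}) \ A))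
    (hs3 : {C : Set α | M.IsCircuit C ∧ C.ncard = 3}.ncard ≤ 10)
    (hlo : 8 ≤ {C : Set α | M.IsCircuit C ∧ C.ncard = 3}.ncard) :
    RLS M 22 6 := by
  classical
  have hR' : M.eRank = ((22 : ℕ) : ℕ∞) := hR
  have hd : M.E.encard = M.eRank + (8 : ℕ) := by
    rw [hR, ← M.ground_finite.cast_ncard_eq, hn]
    push_cast
    ring
  have hc : ∀ X ⊆ M.E, M.eRk X ≤ ((6 - 2 : ℕ) : ℕ∞) → (X.ncard : ℕ∞) ≤ M.eRk X + cnull 4 :=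
    fun X hX hr => nullity_cap_core M hfree 4 (le_refl 4) X hX (by simpa using hr)
  have hc6 : cnull 4 + 1 ≤ 7 := by simp [cnull]
  have hcj : ∀ X ⊆ M.E, M.eRk X ≤ ((6 - 2 - 1 : ℕ) : ℕ∞) → (X.ncard : ℕ∞) ≤ M.eRk X + cnull (3) :=
    fun X hX hr => nullity_cap_core M hfree 3 (by omega) X hX
      (by rwa [show (6 - 2 - 1 : ℕ) = 3 by omega] at hr)
  have hcj' : ∀ X ⊆ M.E, M.eRk X ≤ ((6 - 1 - 1 - 1 : ℕ) : ℕ∞) → (X.ncard : ℕ∞) ≤ M.eRk X + cnull (3) :=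
    fun X hX hr => nullity_cap_core M hfree 3 (by omega) X hX
      (by rwa [show (6 - 1 - 1 - 1 : ℕ) = 3 by omega] at hr)
  have hUG : (Matroid.UG M 6 7).ncard ≤ 13 := by
    have := Matroid.ncard_UG_le_cf (M := M) (q := 6) (ν₁ := 7) (j := 2) (by norm_num) hcf hR' hn (by omega) hc hc6 hcj (by norm_num [cnull])
    simpa using this
  have hUH : (Matroid.UH M 6 7).ncard ≤ 12 := by
    have := Matroid.ncard_UH_le_cf (M := M) (q := 6) (ν₁ := 7) (j' := 1) (by norm_num) hcf hR' hn (by omega) hc hc6 hcj' (by norm_num [cnull])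
    simpa using this
  have hΦ : phiK 22 6 ≤ (2 : ℚ) ^ (22 + 6) / (((22 + 6).choose 6 : ℕ) : ℚ) := phiK_le_two_pow_div_six 22
  obtain ⟨ν, σ, hνd, hσ, hσn, hcq, hcount⟩ := exists_triangle_union_bound M hfree hR' hn
  have hν0 : 6 ≤ ν := by
    by_contra hlt
    have := cq3_lt_eight_of_lt_six ν (by omega)
    omega
  have hX := confined_bound_30_8_6 ν σ hν0 (by omega) hσ (by omega)
  have hX' : ∑ b ∈ Finset.range (8 - ν + 1), (22 + 8 - σ).choose b * σ.choose (6 - b) ≤ 323340 := by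
    rw [show (22 : ℕ) + 8 = 30 by norm_num]; exact hX
  have h6 : {B : Set α | B ⊆ M.E ∧ B.ncard = 6 ∧ M.eRk B = 6 ∧ M.eRk (M.E \ B) = M.eRank}.ncard ≤ 323340 := by
    have hsub : {B : Set α | B ⊆ M.E ∧ B.ncard = 6 ∧ M.eRk B = 6 ∧ M.eRk (M.E \ B) = M.eRank} ⊆
        {B : Set α | B ⊆ M.E ∧ B.ncard = 6 ∧ M.eRk (M.E \ B) = ((22 : ℕ) : ℕ∞)} := by
      rintro B ⟨hBE, hB6, _, hBs⟩
      exact ⟨hBE, hB6, by rw [← hR']; exact hBs⟩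
    have hle := Set.ncard_le_ncard hsub (M.ground_finite.finite_subsets.subset (fun B hB => hB.1))
    exact hle.trans (hcount.trans hX')
  rw [RLS_iff]
  exact c025_core_six_heavy_cell_sq27di2v_x6 M 22 8 7 13 12 0 10000 300 14 432 62 10 1155 2238
      ((22 + 6).choose 6) (Nat.choose_pos (by omega)) (phiK 22 6) hΦ (by norm_num) (by omega)
      (by norm_num) hUG hUH (by omega) (Or.inl (by norm_num)) (by norm_num) (by norm_num) (by norm_num)
      hs3
      ((S1.ncard_fourCircuits_le_gb14 8 M hfree hd 30 (by rw [coloops_eq_empty_of_forall M hcf, Set.sdiff_empty, hn])).trans (by decide))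
      (s5_cf_of M hfree hcf (d := 7) (by rw [hd]; norm_num) 30 360 432 (by norm_num) (by omega) (by decide) (by omega))
      (s6_cf_of M hfree hcf (d := 7) (by rw [hd]; norm_num) 30 924 1155 (by norm_num) (by omega) (by decide) (by omega))
      (s7_cf_of M hfree hcf (d := 7) (by rw [hd]; norm_num) 30 1716 2238 (by norm_num) (by omega) (by decide) (by omega))
      (Or.inl tail_six_confB_sq22F8) hR' hn hfree 323340 h6 level_six_poly_confB_sq22F8

set_option maxHeartbeats 1600000 in
/-- **The coloop-free cell `(22, 8)`, the branch `s₃ = 11`** (form (ii), `X6 = 237405`). -/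
theorem c025_core_six_t22_free8_confC_sq22F8 (M : Matroid α) [M.Finite] (hcf : ∀ e ∈ M.E, ¬ M.IsColoop e)
    (hR : M.eRank = (22 : ℕ∞)) (hn : M.E.ncard = 22 + 8)
    (hfree : ∀ e ∈ M.E, ∃ A ⊆ M.E \ {e}, e ∉ M.closure A ∧ e ∉ M.closure ((M.E \ {e}) \ A))
    (hs3 : {C : Set α | M.IsCircuit C ∧ C.ncard = 3}.ncard ≤ 11)
    (hlo : 11 ≤ {C : Set α | M.IsCircuit C ∧ C.ncard = 3}.ncard) :
    RLS M 22 6 := by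
  classical
  have hR' : M.eRank = ((22 : ℕ) : ℕ∞) := hR
  have hd : M.E.encard = M.eRank + (8 : ℕ) := by
    rw [hR, ← M.ground_finite.cast_ncard_eq, hn]
    push_cast
    ring
  have hc : ∀ X ⊆ M.E, M.eRk X ≤ ((6 - 2 : ℕ) : ℕ∞) → (X.ncard : ℕ∞) ≤ M.eRk X + cnull 4 :=
    fun X hX hr => nullity_cap_core M hfree 4 (le_refl 4) X hX (by simpa using hr)
  have hc6 : cnull 4 + 1 ≤ 7 := by simp [cnull]
  have hcj : ∀ X ⊆ M.E, M.eRk X ≤ ((6 - 2 - 1 : ℕ) : ℕ∞) → (X.ncard : ℕ∞) ≤ M.eRk X + cnull (3) :=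
    fun X hX hr => nullity_cap_core M hfree 3 (by omega) X hX
      (by rwa [show (6 - 2 - 1 : ℕ) = 3 by omega] at hr)
  have hcj' : ∀ X ⊆ M.E, M.eRk X ≤ ((6 - 1 - 1 - 1 : ℕ) : ℕ∞) → (X.ncard : ℕ∞) ≤ M.eRk X + cnull (3) :=
    fun X hX hr => nullity_cap_core M hfree 3 (by omega) X hX
      (by rwa [show (6 - 1 - 1 - 1 : ℕ) = 3 by omega] at hr)
  have hUG : (Matroid.UG M 6 7).ncard ≤ 13 := by
    have := Matroid.ncard_UG_le_cf (M := M) (q := 6) (ν₁ := 7) (j := 2) (by norm_num) hcf hR' hn (by omega) hc hc6 hcj (by norm_num [cnull])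
    simpa using this
  have hUH : (Matroid.UH M 6 7).ncard ≤ 12 := by
    have := Matroid.ncard_UH_le_cf (M := M) (q := 6) (ν₁ := 7) (j' := 1) (by norm_num) hcf hR' hn (by omega) hc hc6 hcj' (by norm_num [cnull])
    simpa using this
  have hΦ : phiK 22 6 ≤ (2 : ℚ) ^ (22 + 6) / (((22 + 6).choose 6 : ℕ) : ℚ) := phiK_le_two_pow_div_six 22
  obtain ⟨ν, σ, hνd, hσ, hσn, hcq, hcount⟩ := exists_triangle_union_bound M hfree hR' hn
  have hν0 : 7 ≤ ν := by
    by_contra hlt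
    have := cq3_lt_eleven_of_lt_seven ν (by omega)
    omega
  have hX := confined_bound_30_8_7 ν σ hν0 (by omega) hσ (by omega)
  have hX' : ∑ b ∈ Finset.range (8 - ν + 1), (22 + 8 - σ).choose b * σ.choose (6 - b) ≤ 237405 := by
    rw [show (22 : ℕ) + 8 = 30 by norm_num]; exact hX
  have h6 : {B : Set α | B ⊆ M.E ∧ B.ncard = 6 ∧ M.eRk B = 6 ∧ M.eRk (M.E \ B) = M.eRank}.ncard ≤ 237405 := by
    have hsub : {B : Set α | B ⊆ M.E ∧ B.ncard = 6 ∧ M.eRk B = 6 ∧ M.eRk (M.E \ B) = M.eRank} ⊆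
        {B : Set α | B ⊆ M.E ∧ B.ncard = 6 ∧ M.eRk (M.E \ B) = ((22 : ℕ) : ℕ∞)} := by
      rintro B ⟨hBE, hB6, _, hBs⟩
      exact ⟨hBE, hB6, by rw [← hR']; exact hBs⟩
    have hle := Set.ncard_le_ncard hsub (M.ground_finite.finite_subsets.subset (fun B hB => hB.1))
    exact hle.trans (hcount.trans hX')
  rw [RLS_iff]
  exact c025_core_six_heavy_cell_sq27di2v_x6 M 22 8 7 13 12 0 10000 300 14 432 62 11 1155 2238
      ((22 + 6).choose 6) (Nat.choose_pos (by omega)) (phiK 22 6) hΦ (by norm_num) (by omega)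
      (by norm_num) hUG hUH (by omega) (Or.inl (by norm_num)) (by norm_num) (by norm_num) (by norm_num)
      hs3
      ((S1.ncard_fourCircuits_le_gb14 8 M hfree hd 30 (by rw [coloops_eq_empty_of_forall M hcf, Set.sdiff_empty, hn])).trans (by decide))
      (s5_cf_of M hfree hcf (d := 7) (by rw [hd]; norm_num) 30 360 432 (by norm_num) (by omega) (by decide) (by omega))
      (s6_cf_of M hfree hcf (d := 7) (by rw [hd]; norm_num) 30 924 1155 (by norm_num) (by omega) (by decide) (by omega))
      (s7_cf_of M hfree hcf (d := 7) (by rw [hd]; norm_num) 30 1716 2238 (by norm_num) (by omega) (by decide) (by omega))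
      (Or.inl tail_six_confC_sq22F8) hR' hn hfree 237405 h6 level_six_poly_confC_sq22F8


/-- **The coloop-free cell `(22, 8)` with `s₃ ≥ 7`** (the three confinement branches; the cap `s₃ ≤ 11`). -/
theorem c025_core_six_t22_free8_conf (M : Matroid α) [M.Finite] (hcf : ∀ e ∈ M.E, ¬ M.IsColoop e)
    (hR : M.eRank = (22 : ℕ∞)) (hn : M.E.ncard = 22 + 8)
    (hfree : ∀ e ∈ M.E, ∃ A ⊆ M.E \ {e}, e ∉ M.closure A ∧ e ∉ M.closure ((M.E \ {e}) \ A))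
    (h7 : 7 ≤ {C : Set α | M.IsCircuit C ∧ C.ncard = 3}.ncard) : RLS M 22 6 := by
  have hR' : M.eRank = ((22 : ℕ) : ℕ∞) := hR
  have hcap : {C : Set α | M.IsCircuit C ∧ C.ncard = 3}.ncard ≤ 11 :=
    (ncard_triangles_le_cq3_pred_of_coloopFree M hfree hcf hR' hn (by omega) (by omega) (by omega)).trans (by decide)
  by_cases h9 : {C : Set α | M.IsCircuit C ∧ C.ncard = 3}.ncard ≤ 9
  · exact c025_core_six_t22_free8_confA_sq22F8 M hcf hR hn hfree h9 h7
  by_cases h10 : {C : Set α | M.IsCircuit C ∧ C.ncard = 3}.ncard ≤ 10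
  · exact c025_core_six_t22_free8_confB_sq22F8 M hcf hR hn hfree h10 (by omega)
  · exact c025_core_six_t22_free8_confC_sq22F8 M hcf hR hn hfree hcap (by omega)

end ThmN

end PercRepro
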